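import Summits.Ventures.PercRepro.S1Tail25
import Summits.Ventures.PercRepro.S1LevelFour

/-!
# PercRepro — S1 LEVEL FOUR, PHASE 2: C-025 at level `4` for every finite matroid and every `p ≥ 26` (p4, gen 14)

The glue of phase 2: the core of rank `25` at every corank (`S1Tail25`) joins the cores of rank `≥ 26`
(`S1LevelFour.c025_core_four_all_corank`) under night-1's wrapper `ThmN.rls_succ_large 3 4 25`.

* **`c025_four_twentysix`** — `ThmN.RLS M p 4` for every `p ≥ 26`; `c025_four_twentysix'` — the literal `C025` body.
Axioms: standard.
-/

open scoped Matroid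

namespace PercRepro

namespace S1

variable {α : Type}

/-- **THE END THEOREM OF PHASE 2**: every finite matroid satisfies C-025 at level `4` for every `p ≥ 26`. -/
theorem c025_four_twentysix (M : Matroid α) [M.Finite] (p : ℕ) (hp : 26 ≤ p) : ThmN.RLS M p 4 := by
  refine ThmN.rls_succ_large (α := α) 3 4 25 ?_ ?_ ?_ M p hp (by omega)
  · intro M' _ p' _ hp'
    exact SevenThree.c025_three_all M' p' (by omega)
  · intro M' _ p' _ hn _
    rcases Nat.lt_or_ge M'.E.ncard (p' + 4) with h | h
    · exact ThmN.RLS_of_ncard_lt M' h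
    · exact ThmN.RLS_of_ncard_eq M' (by omega)
  · intro M' _ p' hP hR hbig _ hfree
    rcases Nat.lt_or_ge p' 26 with h25 | h26
    · have hp25 : p' = 25 := by omega
      subst hp25
      exact c025_core_four_twentyfive M' hR hbig hfree
    · exact c025_core_four_all_corank M' p' h26 hR hbig hfree

/-- The phase-2 theorem in the literal vocabulary of `C025`. -/
theorem c025_four_twentysix' (M : Matroid α) [M.Finite] (p : ℕ) (hp : 26 ≤ p) :
    phiK p 4 * ({A : Set α | A ⊆ M.E ∧ M.eRk A = (p : ℕ∞) ∧ M.eRk (M.E \ A) = (4 : ℕ∞)}.ncard : ℚ) ≤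
      ({A : Set α | A ⊆ M.E ∧ (4 : ℕ∞) < M.eRk A ∧ M.eRk A < (p : ℕ∞)}.ncard : ℚ) :=
  c025_four_twentysix M p hp

end S1

end PercRepro
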